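import Literature.MathematicalPhysics.QuantumFieldTheory.Balaban1983to89.B15Prop1SliceTaylorCalculus
import Literature.MathematicalPhysics.QuantumFieldTheory.Balaban1983to89.B15Prop1ParametricZeroBranch

/-!
# `Balaban1983to89.B15Prop1IntrinsicAnalyticExt` — [Balaban1989LargeFieldI] Prop. 1 p. 194, last clause (*«The orbit-valued function
# V_Λ(V_k↾_{Z∩Λᶜ}) has an analytic extension for Gᶜ-valued configurations 𝕍_k = exp iB′V_k … with B′ ∈ 𝔤ᶜ and small»*) IN THE INTRINSIC READING:
# the clause `B15Prop1AnalyticExtClause.anExt` from ONE jointly holomorphic extension of print's function `(p, B′) ↦ A(U_{k,Z}(exp(iB′)·ext(exp(ip)V_k)))`,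
# its Hessian positivity at the origin and the smallness of its gradient — [Balaban1989LargeFieldII] p. 359 *«valid for 𝔤ᶜ-valued fields, hence the
# existence of the analytic extension follows immediately»* with ALL expansion pieces moving with the datum

statement-level skeleton of published theorems with citation tags; proofs where landed; nothing here is a claim about
the Yang–Mills mass gap

Cell pub-ymgap, HUMAN RULING D-0062 (Track A full width), seat `pub-ymgap-dag-n12-c` (R134 acceleration seat (a), strategy s1 of DAG node N12 = [B15];
generation g5, fourth product).  PDFs held: `paper:balaban1989-cmp122-large-field-i` (p. 194), `…-large-field-ii` (p. 359 = PDF 5).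

WHY.  g4 discharged the clause `anExt` from r13's complex model (`B15Prop1AnalyticExtClause.anExt_of_complexModel`, p504654) under the FIXED-OPERATOR
reading (`H_{1,k}`, `Δ₁(ζ₀)`, `(δ/δA)V` the reference-background operators, the datum entering through the current; HONEST SCOPE (ii) there:
*«a datum-dependent H_{1,k} would need the parametric analytic implicit-function theorem»*).  In the intrinsic reading (`B15Prop1IntrinsicReading`,
p513628) the criticality equation of the perturbed datum `exp(ip)V_k` is `∇_{B′} g(p, B′) = 0` for print's ONE function `g(p, B′) =
A(U_{k,Z}(exp(iB′)·ext(exp(ip)V_k)))`, whose Taylor data all move with `p`; the parametric statement is `B15Prop1ParametricZeroBranch.exists_analytic_zero_branch`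
(g5, third product, p516033: Earle–Hamilton + the Banach Weierstrass theorem, BY NAME).  This file applies it on the complexified slice.

WHAT THIS FILE PROVES (the two imports; theorems only; no `sorry`, no definition, no `… : Prop` fact; axioms standard).
§0 `inner_cplxSlice`, `re_inner_span`, `norm_sq_span`, `re_inner_coercive_of_real` — the real structure of the complexified slice: a `ℂ`-linear map `L`
   with `L(ιu) = ι(Δu)` inherits coercivity `c‖x‖² ≤ Re⟪x, Lx⟫` from the real positivity `c‖u‖² ≤ ⟪u, Δu⟫` (no symmetry of `Δ` needed).
§1 `jointSlice_differentiableOn` — the joint holomorphic extension restricted to the complexified slice (`𝒢s(p̃, B̃) = 𝒢(p̃, ιAc B̃)`) is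
   complex-differentiable on the sup-ball.  (Inside the proof of §2: its `B̃`-gradient family `𝒦(p̃, B̃) = rieszC (D𝒢s(p̃,B̃) ∘ inr)` is
   complex-differentiable on `‖(p̃,B̃)‖ < R/2` and bounded by `4𝓐/R` there (Cauchy on the sections), equals `ι(rGrad g_p B)` at real points
   (`cGrad_cplxSlice`), and `∂_{B̃}𝒦(0,0)` is the complexified real Hessian (`fderiv_cGrad_cplxSlice`).)
§2 ★★★ **`anExt_of_jointHolomorphic`** — for a datum `V_k`: from (J1) a function `𝒢`, complex-differentiable on the sup-ball `‖(p̃, B̃′)‖ < R` of pairs of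
   `𝔤ᶜ`-valued bond fields and bounded by `𝓐` there, agreeing at real points with `(p, B′) ↦ f(exp(iB′)·ext(exp(ip)V_k))`; (J2) `hcrit`: at every real
   `‖p‖ < R/2`, every critical coordinate `B` (`‖B‖ ≤ r`) of the perturbed datum has `rGrad g_p B = 0` (the (c3)∕(1.12) letter in the intrinsic reading —
   derived at the record in the sequel); (J3) positivity of the real Hessian of `g_0` at `0` with constant `c`; (J4) `‖rGrad g_0 0‖ ≤ j`; and explicit
   radii `r′, ε` with the smallness conditions of the zero-branch theorem (`𝓑 = 4𝓐/R + 1`, `ρ₀ = R/2`) and `r < r′` — THE CLAUSE `anExt S T f ext r ε V_k`.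

HONEST SCOPE.  (i) Letters (J1)–(J4) are NODE 00's: joint analyticity of [15]'s minimizer composed with the Wilson action and the p. 193 extension
([15] Thm 1; [LF-II] p. 359), (1.7)–(1.9) for the Hessian, the smallness of the gradient; nothing of theirs is constructed here.  (ii) The clause is
proved through the gauge-fixed coordinate, as typed in `anExt`.  (iii) `SU(2)`; radii explicit and small.  Count-neutral; NOT a discharge of N12; NOT
summit progress; nothing continuum ∕ OS ∕ mass-gap ∕ Clay.
-/

noncomputable section

open Set Metric Filter
open scoped InnerProductSpace Topology

namespace Literature.MathematicalPhysics.QuantumFieldTheory.Balaban1983to89.B15Prop1IntrinsicAnalyticExt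

open B15DeterminingSets GaugeField B15Prop1Carrier B16Sect1Backgrounds
open B15Prop1SliceCoordinates (GaugeSlice ιA freeBonds norm_ιA_apply_le)
open B15Prop1AnalyticExtClause (cplxVec cplxSlice cplxSlice_apply norm_cplxSlice norm_cplxVec cplxSlice_span anExt)
open B15Prop1ChartCalculusSU2 (E3)
open B15Prop1ChartSU2 (su2Chart)
open T4CubeChartGnomonic (SU2)
open B15Prop1SliceTaylorCalculus B15Prop1ParametricZeroBranch
open B16Prop1IVInverseC (exists_inverse_of_pos)
open Literature.Analysis.Complex (norm_fderiv_le_of_forall_mem_ball_norm_le)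

variable {P : Params} {k : ℕ} [DecidableEq (PBond P k)]

/-! ## §0 The real structure of the complexified slice -/

section RealStructure

variable (S : Set (Site P k)) (T : Finset (PBond P k))

/-- `⟪ιu, ιv⟫_ℂ = ⟪u, v⟫_ℝ`: the complexified coordinates are totally real. [cite: Balaban1989LargeFieldI, Prop. 1 p.194 («B′ ∈ 𝔤ᶜ»)] -/
theorem inner_cplxSlice (u v : GaugeSlice S T E3) : ⟪cplxSlice S T u, cplxSlice S T v⟫_ℂ = ((⟪u, v⟫_ℝ : ℝ) : ℂ) := by
  rw [PiLp.inner_apply, inner_eq_sum_real]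
  push_cast
  refine Finset.sum_congr rfl fun b _ => ?_
  rw [PiLp.inner_apply]
  refine Finset.sum_congr rfl fun j _ => ?_
  simp [cplxSlice_apply, mul_comm]

/-- `Re⟪ιa + i·ιb, ιc + i·ιd⟫_ℂ = ⟪a, c⟫ + ⟪b, d⟫` (the cross terms are purely imaginary). [cite: Balaban1989LargeFieldI, Prop. 1 p.194] -/
theorem re_inner_span (a b c d : GaugeSlice S T E3) :
    RCLike.re ⟪cplxSlice S T a + (Complex.I : ℂ) • cplxSlice S T b, cplxSlice S T c + (Complex.I : ℂ) • cplxSlice S T d⟫_ℂ =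
      ⟪a, c⟫_ℝ + ⟪b, d⟫_ℝ := by
  simp only [inner_add_left, inner_add_right, inner_smul_left, inner_smul_right, inner_cplxSlice, Complex.conj_I]
  simp [Complex.add_re, Complex.mul_re, Complex.ofReal_re, Complex.ofReal_im, Complex.I_re, Complex.I_im]

/-- `‖ιa + i·ιb‖² = ‖a‖² + ‖b‖²`. [cite: Balaban1989LargeFieldI, Prop. 1 p.194] -/
theorem norm_sq_span (a b : GaugeSlice S T E3) :
    ‖cplxSlice S T a + (Complex.I : ℂ) • cplxSlice S T b‖ ^ 2 = ‖a‖ ^ 2 + ‖b‖ ^ 2 := by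
  rw [@norm_sq_eq_re_inner ℂ, re_inner_span, real_inner_self_eq_norm_sq, real_inner_self_eq_norm_sq]

/-- **COERCIVITY OF THE COMPLEXIFIED HESSIAN FROM THE REAL POSITIVITY** (the complex (1.9): *«valid for 𝔤ᶜ-valued fields»*): a `ℂ`-linear `L` on the
complexified slice with `L(ιu) = ι(Δu)` for a real map `Δ` with `c‖u‖² ≤ ⟪u, Δu⟫` satisfies `c‖x‖² ≤ Re⟪x, Lx⟫` for every complex `x`.
[cite: Balaban1989LargeFieldII, (1.9) p.358, p.359 («valid for 𝔤ᶜ-valued fields»)] -/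
theorem re_inner_coercive_of_real (L : GaugeSlice S T (EuclideanSpace ℂ (Fin 3)) →L[ℂ] GaugeSlice S T (EuclideanSpace ℂ (Fin 3)))
    (Δ : GaugeSlice S T E3 → GaugeSlice S T E3) (hL : ∀ u, L (cplxSlice S T u) = cplxSlice S T (Δ u)) {c : ℝ}
    (hpos : ∀ u : GaugeSlice S T E3, c * ‖u‖ ^ 2 ≤ ⟪u, Δ u⟫_ℝ) (x : GaugeSlice S T (EuclideanSpace ℂ (Fin 3))) :
    c * ‖x‖ ^ 2 ≤ RCLike.re ⟪x, L x⟫_ℂ := by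
  obtain ⟨a, b, rfl⟩ := cplxSlice_span S T x
  rw [map_add, map_smul, hL, hL, re_inner_span, norm_sq_span, mul_add]
  exact add_le_add (hpos a) (hpos b)

end RealStructure

/-! ## §1 The joint extension on the complexified slice and its gradient family -/

section Joint

variable (S : Set (Site P k)) (T : Finset (PBond P k))

/-- The joint extension pulled back to the complexified slice is complex-differentiable on the sup-ball (`‖ιAc B̃‖ ≤ ‖B̃‖`).
[cite: Balaban1989LargeFieldII, p.359 («valid for 𝔤ᶜ-valued fields»)] -/
theorem jointSlice_differentiableOn {𝒢 : VecField P k (EuclideanSpace ℂ (Fin 3)) × VecField P k (EuclideanSpace ℂ (Fin 3)) → ℂ} {R : ℝ}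
    (h𝒢 : DifferentiableOn ℂ 𝒢 (ball 0 R)) :
    DifferentiableOn ℂ (fun z : VecField P k (EuclideanSpace ℂ (Fin 3)) × GaugeSlice S T (EuclideanSpace ℂ (Fin 3)) => 𝒢 (z.1, ιAc S T z.2))
      (ball 0 R) := by
  refine h𝒢.comp (differentiableOn_fst.prodMk ((ιAc S T).differentiable.comp differentiable_snd).differentiableOn) fun z hz => ?_
  rw [mem_ball_zero_iff, Prod.norm_def] at hz ⊢
  exact max_lt (lt_of_le_of_lt (le_max_left _ _) hz) ((norm_ιAc_le S T z.2).trans_lt (lt_of_le_of_lt (le_max_right _ _) hz))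

/-- ★★★ **THE ANALYTIC-EXTENSION CLAUSE FROM ONE JOINT HOLOMORPHIC EXTENSION (intrinsic reading).**  See the module docstring, §2.  Data: `f`, `ext`, the
datum `V_k`; (J1) `𝒢` complex-differentiable on `‖(p̃, B̃′)‖ < R` (sup norm on pairs of `𝔤ᶜ`-valued bond fields), `‖𝒢‖ ≤ 𝓐` there, `𝒢(cplxVec p, cplxVec B′)
= f(exp(iB′)·ext(exp(ip)V_k))` for real `‖p‖, ‖B′‖ < R`; (J2) `hcrit`; (J3) `hpos` for `Δ := D(rGrad g₀)(0)`, `g₀ = sliceFn S T f (ext V_k)`; (J4) `hj`; radii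
`0 < r < r′`, `r′ ≤ R/4`, `r′ ≤ c(R/2)²/(24𝓑)`, `ε ≤ r′`, `ε ≤ c·r′·(R/2)/(12𝓑)`, `j ≤ c·r′/6` with `𝓑 = 4𝓐/R + 1`.  Conclusion: `anExt S T f ext r ε V_k` —
a map `Φ`, analytic on `‖p̃‖ < ε`, with `Φ(cplxVec p) = ι B` for every real `‖p‖ < ε` and every critical coordinate `‖B‖ ≤ r` of the perturbed datum.
[cite: Balaban1989LargeFieldI, Prop. 1 p.194; Balaban1989LargeFieldII, (1.12)–(1.13) p.359 («valid for 𝔤ᶜ-valued fields, hence the existence of the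
analytic extension follows immediately»)] -/
theorem anExt_of_jointHolomorphic (f : GaugeField P k SU2 → ℝ) (ext : GaugeField P k SU2 → GaugeField P k SU2) (Vk : GaugeField P k SU2)
    {R 𝓐 c j r r' ε : ℝ} (hR : 0 < R) (h𝓐 : 0 ≤ 𝓐)
    (𝒢 : VecField P k (EuclideanSpace ℂ (Fin 3)) × VecField P k (EuclideanSpace ℂ (Fin 3)) → ℂ)
    (h𝒢d : DifferentiableOn ℂ 𝒢 (ball 0 R))
    (h𝒢b : ∀ z ∈ ball (0 : VecField P k (EuclideanSpace ℂ (Fin 3)) × VecField P k (EuclideanSpace ℂ (Fin 3))) R, ‖𝒢 z‖ ≤ 𝓐)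
    (h𝒢r : ∀ (p B' : VecField P k E3), ‖p‖ < R → ‖B'‖ < R →
      𝒢 (cplxVec p, cplxVec B') = ((f (expMul su2Chart B' (ext (expMul su2Chart p Vk))) : ℝ) : ℂ))
    (hcrit : ∀ p : VecField P k E3, ‖p‖ < R / 2 → ∀ B : GaugeSlice S T E3, ‖B‖ ≤ r →
      IsCriticalPt su2Chart (bondsOf S) f (expMul su2Chart (ιA S T B) (ext (expMul su2Chart p Vk))) →
        rGrad S T (sliceFn S T f (ext (expMul su2Chart p Vk))) B = 0)
    (hc : 0 < c)
    (hpos : ∀ u : GaugeSlice S T E3, c * ‖u‖ ^ 2 ≤ ⟪u, fderiv ℝ (rGrad S T (sliceFn S T f (ext Vk))) 0 u⟫_ℝ)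
    (hj : ‖rGrad S T (sliceFn S T f (ext Vk)) 0‖ ≤ j)
    (hr : 0 < r) (hrr' : r < r') (hr'R : r' ≤ R / 4) (hr'c : r' ≤ c * (R / 2) ^ 2 / (24 * (4 * 𝓐 / R + 1)))
    (hεr : ε ≤ r') (hεc : ε ≤ c * r' * (R / 2) / (12 * (4 * 𝓐 / R + 1))) (hjc : j ≤ c * r' / 6) :
    anExt S T f ext r ε Vk := by
  -- the `ContinuousSMul` instances of the doubly-`PiLp` slices along their normed-space paths (instance search for them is slow)
  haveI : ContinuousSMul ℂ (GaugeSlice S T (EuclideanSpace ℂ (Fin 3))) := IsBoundedSMul.continuousSMul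
  haveI : ContinuousSMul ℝ (GaugeSlice S T E3) := IsBoundedSMul.continuousSMul
  set 𝓑 : ℝ := 4 * 𝓐 / R + 1 with h𝓑
  have h𝓑0 : 0 < 𝓑 := by rw [h𝓑]; positivity
  have hR2 : 0 < R / 2 := by linarith
  -- the joint slice function and its gradient family
  set 𝒢s : VecField P k (EuclideanSpace ℂ (Fin 3)) × GaugeSlice S T (EuclideanSpace ℂ (Fin 3)) → ℂ := fun z => 𝒢 (z.1, ιAc S T z.2) with h𝒢s
  have h𝒢sd : DifferentiableOn ℂ 𝒢s (ball 0 R) := jointSlice_differentiableOn S T h𝒢d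
  have h𝒢sA : AnalyticOnNhd ℂ 𝒢s (ball 0 R) :=
    Literature.Analysis.Complex.HolomorphicBanach.analyticOnNhd_of_differentiableOn h𝒢sd isOpen_ball
  set 𝒦 : VecField P k (EuclideanSpace ℂ (Fin 3)) × GaugeSlice S T (EuclideanSpace ℂ (Fin 3)) →
      GaugeSlice S T (EuclideanSpace ℂ (Fin 3)) := fun z => rieszC S T ((fderiv ℂ 𝒢s z).comp (ContinuousLinearMap.inr ℂ (VecField P k (EuclideanSpace ℂ (Fin 3))) (GaugeSlice S T (EuclideanSpace ℂ (Fin 3))))) with h𝒦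
  -- `𝒦` is the `B̃`-gradient of the section, on the ball
  have h𝒦_eq : ∀ z ∈ ball (0 : VecField P k (EuclideanSpace ℂ (Fin 3)) × GaugeSlice S T (EuclideanSpace ℂ (Fin 3))) R, 𝒦 z = cGrad S T (fun Y => 𝒢s (z.1, Y)) z.2 := by
    intro z hz
    have hdz : DifferentiableAt ℂ 𝒢s z := h𝒢sd.differentiableAt (isOpen_ball.mem_nhds hz)
    rw [cGrad_def]
    show rieszC S T ((fderiv ℂ 𝒢s z).comp (ContinuousLinearMap.inr ℂ (VecField P k (EuclideanSpace ℂ (Fin 3))) (GaugeSlice S T (EuclideanSpace ℂ (Fin 3))))) =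
      rieszC S T (fderiv ℂ (fun Y => 𝒢s (z.1, Y)) z.2)
    rw [(hasFDerivAt_section 𝒢s hdz).fderiv]
  -- `𝒦` is complex-differentiable on the ball
  have h𝒦d : DifferentiableOn ℂ 𝒦 (ball 0 (R / 2)) := by
    have h1 : DifferentiableOn ℂ (fderiv ℂ 𝒢s) (ball 0 R) := h𝒢sA.fderiv.differentiableOn
    have h2 : DifferentiableOn ℂ (fun z => (fderiv ℂ 𝒢s z).comp
        (ContinuousLinearMap.inr ℂ (VecField P k (EuclideanSpace ℂ (Fin 3))) (GaugeSlice S T (EuclideanSpace ℂ (Fin 3))))) (ball 0 R) :=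
      h1.clm_comp (differentiableOn_const _)
    exact ((rieszC S T).differentiable.comp_differentiableOn h2).mono (ball_subset_ball (by linarith))
  -- `𝒦` is bounded by `4𝓐/R ≤ 𝓑` on the half ball (Cauchy on the `B̃`-sections)
  have h𝒦b : ∀ z ∈ ball (0 : VecField P k (EuclideanSpace ℂ (Fin 3)) × GaugeSlice S T (EuclideanSpace ℂ (Fin 3))) (R / 2), ‖𝒦 z‖ ≤ 𝓑 := by
    intro z hz
    have hzR : z ∈ ball (0 : VecField P k (EuclideanSpace ℂ (Fin 3)) × GaugeSlice S T (EuclideanSpace ℂ (Fin 3))) R := ball_subset_ball (by linarith) hz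
    rw [mem_ball_zero_iff, Prod.norm_def] at hz
    have hz1 : ‖z.1‖ < R / 2 := lt_of_le_of_lt (le_max_left _ _) hz
    have hz2 : ‖z.2‖ < R / 2 := lt_of_le_of_lt (le_max_right _ _) hz
    rw [h𝒦_eq z hzR]
    -- the section at `z.1` is differentiable on `ball z.2 (R/2) ⊆ ball 0 R` and bounded by `𝓐`
    have hsub : ∀ Y ∈ ball z.2 (R / 2), (z.1, Y) ∈ ball (0 : VecField P k (EuclideanSpace ℂ (Fin 3)) × GaugeSlice S T (EuclideanSpace ℂ (Fin 3))) R := by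
      intro Y hY
      rw [mem_ball, dist_eq_norm] at hY
      rw [mem_ball_zero_iff, Prod.norm_def]
      refine max_lt (by linarith) ?_
      calc ‖Y‖ = ‖(Y - z.2) + z.2‖ := by rw [sub_add_cancel]
        _ ≤ ‖Y - z.2‖ + ‖z.2‖ := norm_add_le _ _
        _ < R / 2 + R / 2 := add_lt_add hY hz2
        _ = R := by ring
    have hsec : DifferentiableOn ℂ (fun Y => 𝒢s (z.1, Y)) (ball z.2 (R / 2)) :=
      h𝒢sd.comp ((differentiableOn_const z.1).prodMk differentiableOn_id) fun Y hY => hsub Y hY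
    have hsecb : ∀ Y ∈ ball z.2 (R / 2), ‖𝒢s (z.1, Y)‖ ≤ 𝓐 := fun Y hY => by
      simp only [h𝒢s]
      refine h𝒢b _ ?_
      have h := hsub Y hY
      rw [mem_ball_zero_iff, Prod.norm_def] at h ⊢
      exact max_lt (lt_of_le_of_lt (le_max_left _ _) h) ((norm_ιAc_le S T Y).trans_lt (lt_of_le_of_lt (le_max_right _ _) h))
    calc ‖cGrad S T (fun Y => 𝒢s (z.1, Y)) z.2‖ ≤ ‖fderiv ℂ (fun Y => 𝒢s (z.1, Y)) z.2‖ := norm_cGrad_le S T _ _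
      _ ≤ 2 * 𝓐 / (R / 2) := norm_fderiv_le_of_forall_mem_ball_norm_le hR2 hsec hsecb
      _ = 4 * 𝓐 / R := by field_simp; ring
      _ ≤ 𝓑 := by rw [h𝓑]; linarith
  -- real sections: the slice function of the perturbed datum
  have hsec_real : ∀ p : VecField P k E3, ‖p‖ < R →
      DifferentiableOn ℂ (fun Y => 𝒢s (cplxVec p, Y)) (ball 0 R) ∧
      ∀ X : GaugeSlice S T E3, ‖X‖ < R →
        𝒢s (cplxVec p, cplxSlice S T X) = ((sliceFn S T f (ext (expMul su2Chart p Vk)) X : ℝ) : ℂ) := by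
    intro p hp
    have hpC : ‖cplxVec p‖ < R := by rw [norm_cplxVec]; exact hp
    refine ⟨differentiableOn_section 𝒢s h𝒢sd hpC, fun X hX => ?_⟩
    simp only [h𝒢s, ιAc_cplxSlice, sliceFn_apply]
    exact h𝒢r p (ιA S T X) hp ((norm_ιA_le S T X).trans_lt hX)
  -- `𝒦` at real points is the complexified real gradient
  have h𝒦_real : ∀ p : VecField P k E3, ‖p‖ < R / 2 → ∀ B : GaugeSlice S T E3, ‖B‖ < R / 2 →
      𝒦 (cplxVec p, cplxSlice S T B) = cplxSlice S T (rGrad S T (sliceFn S T f (ext (expMul su2Chart p Vk))) B) := by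
    intro p hp B hB
    have hpR : ‖p‖ < R := by linarith
    obtain ⟨hd, hagr⟩ := hsec_real p hpR
    have hz : ((cplxVec p, cplxSlice S T B) : VecField P k (EuclideanSpace ℂ (Fin 3)) × GaugeSlice S T (EuclideanSpace ℂ (Fin 3))) ∈ ball (0 : VecField P k (EuclideanSpace ℂ (Fin 3)) × GaugeSlice S T (EuclideanSpace ℂ (Fin 3))) R := by
      rw [mem_ball_zero_iff, Prod.norm_def, norm_cplxVec, norm_cplxSlice]
      exact max_lt hpR (by linarith)
    rw [h𝒦_eq _ hz]
    have hBR : ‖B‖ < R := by linarith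
    exact cGrad_cplxSlice S T (hd.differentiableAt (isOpen_ball.mem_nhds (by rw [mem_ball_zero_iff, norm_cplxSlice]; exact hBR)))
      (Filter.eventually_of_mem ((isOpen_lt continuous_norm continuous_const).mem_nhds hBR) fun X hX => hagr X hX)
  -- the linearisation `L = D𝒦(0) ∘ inr` is the complexified real Hessian
  set L : GaugeSlice S T (EuclideanSpace ℂ (Fin 3)) →L[ℂ] GaugeSlice S T (EuclideanSpace ℂ (Fin 3)) := (fderiv ℂ 𝒦 0).comp (ContinuousLinearMap.inr ℂ (VecField P k (EuclideanSpace ℂ (Fin 3))) (GaugeSlice S T (EuclideanSpace ℂ (Fin 3)))) with hLdef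
  have hL_real : ∀ u : GaugeSlice S T E3, L (cplxSlice S T u) = cplxSlice S T (fderiv ℝ (rGrad S T (sliceFn S T f (ext Vk))) 0 u) := by
    intro u
    obtain ⟨hd0, hagr0⟩ := hsec_real 0 (by rw [norm_zero]; exact hR)
    have h0mem : (0 : VecField P k (EuclideanSpace ℂ (Fin 3)) × GaugeSlice S T (EuclideanSpace ℂ (Fin 3))) ∈ ball (0 : VecField P k (EuclideanSpace ℂ (Fin 3)) × GaugeSlice S T (EuclideanSpace ℂ (Fin 3))) (R / 2) := mem_ball_self hR2
    -- `L = D(B̃ ↦ 𝒦(0,B̃))(0)` and `B̃ ↦ 𝒦(0,B̃)` agrees with `cGrad (𝒢s(0,·))` near `0`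
    have h1 : L = fderiv ℂ (fun B' : GaugeSlice S T (EuclideanSpace ℂ (Fin 3)) => 𝒦 ((0 : VecField P k (EuclideanSpace ℂ (Fin 3)) × GaugeSlice S T (EuclideanSpace ℂ (Fin 3))).1, B')) (0 : VecField P k (EuclideanSpace ℂ (Fin 3)) × GaugeSlice S T (EuclideanSpace ℂ (Fin 3))).2 := by
      rw [hLdef, (hasFDerivAt_section 𝒦 (h𝒦d.differentiableAt (isOpen_ball.mem_nhds h0mem))).fderiv]
    have h2 : (fun B' : GaugeSlice S T (EuclideanSpace ℂ (Fin 3)) => 𝒦 ((0 : VecField P k (EuclideanSpace ℂ (Fin 3))), B')) =ᶠ[𝓝 (0 : GaugeSlice S T (EuclideanSpace ℂ (Fin 3)))] cGrad S T (fun Y => 𝒢s (cplxVec (0 : VecField P k E3), Y)) := by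
      have hopen : IsOpen (ball (0 : GaugeSlice S T (EuclideanSpace ℂ (Fin 3))) (R / 2)) := isOpen_ball
      filter_upwards [hopen.mem_nhds (mem_ball_self hR2)] with B' hB'
      have hz : (((0 : VecField P k (EuclideanSpace ℂ (Fin 3))), B') : VecField P k (EuclideanSpace ℂ (Fin 3)) × GaugeSlice S T (EuclideanSpace ℂ (Fin 3))) ∈ ball (0 : VecField P k (EuclideanSpace ℂ (Fin 3)) × GaugeSlice S T (EuclideanSpace ℂ (Fin 3))) R := by
        rw [mem_ball_zero_iff] at hB' ⊢
        rw [Prod.norm_def, norm_zero]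
        exact max_lt hR (by linarith)
      rw [h𝒦_eq _ hz]
      have hc0 : cplxVec (0 : VecField P k E3) = (0 : VecField P k (EuclideanSpace ℂ (Fin 3))) := by
        funext b; ext i; simp [cplxVec]
      rw [hc0]
    have h3 : fderiv ℂ (fun B' : GaugeSlice S T (EuclideanSpace ℂ (Fin 3)) => 𝒦 ((0 : VecField P k (EuclideanSpace ℂ (Fin 3))), B')) 0 = fderiv ℂ (cGrad S T (fun Y => 𝒢s (cplxVec (0 : VecField P k E3), Y))) 0 :=
      h2.fderiv_eq
    have h4 := fderiv_cGrad_cplxSlice S T hR hd0 hagr0 u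
    simp only [expMul_zero] at h4
    have e : L = fderiv ℂ (cGrad S T (fun Y => 𝒢s (cplxVec (0 : VecField P k E3), Y))) 0 := by
      rw [h1]; exact h3
    rw [e]; exact h4
  -- coercivity of `L` and its inverse (r13's `exists_inverse_of_pos` with `P₀ = H = H* = id`)
  have hLpos : ∀ x : GaugeSlice S T (EuclideanSpace ℂ (Fin 3)), c * ‖x‖ ^ 2 ≤ RCLike.re ⟪x, L x⟫_ℂ :=
    re_inner_coercive_of_real S T L _ hL_real hpos
  obtain ⟨Kinv, hKL, hLK, -, -, hKn⟩ := exists_inverse_of_pos (𝕜 := ℂ) (ContinuousLinearMap.id ℂ (GaugeSlice S T (EuclideanSpace ℂ (Fin 3)))) (fun _ => rfl) (fun _ _ => rfl)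
    (ContinuousLinearMap.id ℂ (GaugeSlice S T (EuclideanSpace ℂ (Fin 3)))) (ContinuousLinearMap.id ℂ (GaugeSlice S T (EuclideanSpace ℂ (Fin 3)))) (fun _ _ => rfl) L hc (fun x _ => by simpa using hLpos x)
  simp only [ContinuousLinearMap.coe_id', id_eq] at hKL hLK hKn
  -- `‖𝒦 0‖ = ‖rGrad g₀ 0‖ ≤ j`
  have h𝒦0 : ‖𝒦 0‖ ≤ c * r' / 6 := by
    have h := h𝒦_real 0 (by rw [norm_zero]; exact hR2) 0 (by rw [norm_zero]; exact hR2)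
    have hc0 : cplxVec (0 : VecField P k E3) = (0 : VecField P k (EuclideanSpace ℂ (Fin 3))) := by
      funext b; ext i; simp [cplxVec]
    rw [hc0, map_zero] at h
    have e0 : ((0 : VecField P k (EuclideanSpace ℂ (Fin 3))), (0 : GaugeSlice S T (EuclideanSpace ℂ (Fin 3)))) = (0 : VecField P k (EuclideanSpace ℂ (Fin 3)) × GaugeSlice S T (EuclideanSpace ℂ (Fin 3))) := rfl
    rw [e0] at h
    rw [h, norm_cplxSlice]
    simp only [expMul_zero]
    exact hj.trans hjc
  -- the analytic zero branch
  have hr' : 0 < r' := hr.trans hrr'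
  have hr'ρ : r' ≤ R / 2 / 2 := by linarith
  obtain ⟨Φ, hΦA, hΦ⟩ := exists_analytic_zero_branch 𝒦 hR2 h𝒦d h𝒦b h𝓑0 Kinv hKL hLK hc hKn hr' hr'ρ hr'c hεr hεc h𝒦0
  refine ⟨Φ, hΦA, fun p hp B hB hcritB => ?_⟩
  have hε2 : ε < R / 2 := by linarith
  have hpmem : cplxVec p ∈ ball (0 : VecField P k (EuclideanSpace ℂ (Fin 3))) ε := by rw [mem_ball_zero_iff, norm_cplxVec]; exact hp
  obtain ⟨-, -, huniq⟩ := hΦ (cplxVec p) hpmem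
  symm
  refine huniq (cplxSlice S T B) (by rw [mem_ball_zero_iff, norm_cplxSlice]; linarith) ?_
  rw [h𝒦_real p (hp.trans hε2) B (by linarith), hcrit p (hp.trans hε2) B hB hcritB, map_zero]

end Joint

end Literature.MathematicalPhysics.QuantumFieldTheory.Balaban1983to89.B15Prop1IntrinsicAnalyticExt

end
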